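import Summits.NavierStokesRegularity.FluidComputer.PalasekTowerRegisterGlobalCeiling
import Literature.Analysis.FluidPDE.ClassicalShortTimeSupBound

/-!
# REGISTER v2.3′: the Kato/Leray sub-window of every growth window is overshoot-free
# (the a-priori ceiling holds by THEOREM on `[τ_k, τ_k + c₀ν/(c₂Y_k)²)`; its open content is the
# rest of the rigid window)

Cell `ns-blowup`, seat `ns-blowup-ecbridge-8` (g2, literature-prover); companion of
`PalasekTowerRegisterGlobalCeiling.lean` (p425507, ecbridge-5 g2: the named upper half
`AprioriCeiling` of the child crux `HeredityFromTwo`, item stmt-NavierStokesRegularity-19250,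
with `ContinuationEnvelope ↔ AprioriCeiling`), `PalasekTowerRegisterGlobalHalves.lean` (p419350:
silent-window uniqueness, `Schedule.Rigid.window_mul_ceiling_sq`) and the Literature theorem
`Literature.Analysis.FluidPDE.exists_norm_le_two_mul_of_finiteEnergy`
(`ClassicalShortTimeSupBound.lean`, p429084: Leray 1934 §19 (3.8) / §21 (3.15) for finite-energy
classical solutions — `|u(0,·)| ≤ A ⇒ |u(t,·)| ≤ 2A` for `t < c₀ν/A²`, no a-priori boundedness).
LABEL: E–C typing (KERNEL bookkeeping; every statement PROVED, no `Prop` introduced, no named fact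
used). WHAT THIS IS NOT: not Navier–Stokes evidence — nothing is constructed; nothing here says
anything about the flow of a registered stage beyond the first `c₀/(c₂Y_k)²` of its growth window,
and `c₀` is the (small, existential) constant of Oseen's scheme.

## What is proved

* §1 `Stage.exists_kato_window` — ANY rates, ANY margins, ANY `ν > 0`, quiet schedule, ANY level
  `k ≥ 1`: every finite-energy classical continuation `(u, p)` of a registered stage `s` (agreement
  in velocity on `[0, τ_k]`) to a closed slab `[0, T']`, `T' ≥ τ_k`, satisfies
  `|u(t, x)| ≤ 2 c₂ Y_k` for all `t ∈ [0, T']` with `t - τ_k < c₀ ν / (c₂ Y_k)²`. Proof: on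
  `[0, τ_k]` this is the stage's own ceiling; past `τ_k` the force is silent (`Quiet`, `k ≥ 1`), the
  translate by `τ_k` is an unforced finite-energy classical solution from the datum `s.u(τ_k)`,
  which is bounded by `c₂ Y_k` (the level-`k` ceiling at its readout) — apply Leray's bound.
* §2 `norm_le_ceiling_of_kato_window` — on the wide rates with the registered constants
  (`Rigid`: `c₂ = 5/3`; `TowerRates.wide_sep`: `2Y_k ≤ Y_{k+1}`) the bound `2c₂Y_k` is inside the
  NEXT ceiling `c₂Y_{k+1}`: with the binders of `AprioriCeiling` (and at every level `k ≥ 1`, so the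
  level-`1` upper half of `HeredityAtOne` is covered too), NO finite-energy classical continuation
  of a registered stage overshoots `c₂ Y_{k+1}` at any time `t < τ_k + c₀/(c₂Y_k)²`.
* §3 `exists_aprioriCeiling_iff_late` — hence `AprioriCeiling` is EQUIVALENT to its restriction to
  the late times `t ≥ τ_k + c₀/(c₂Y_k)²` of each window: the open content of the upper half of
  `HeredityFromTwo` is «no overshoot of `c₂Y_{k+1}` on `[τ_k + c₀/(c₂Y_k)², τ_{k+1}]`», for the
  (unique, `Stage.continuation_velocity_eq`) continuation of each registered stage.
* §4 `Schedule.Rigid.kato_fraction` — the number: the overshoot-free sub-window is the fraction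
  `c₀ / (c₂² · 4bβ · log N_{k+1} · N_k^{β-2})` of the rigid window (`window_mul_ceiling_sq`; on the
  wide rates the denominator is `≈ 1.55·10³` at `k = 2` and unbounded in `k`). This is a LOCATED,
  SMALL fraction: the theorem removes the beginning of each window from the open statement and
  nothing more.

References: J. Leray, Acta Math. 63 (1934), §19 (3.8), §21 (3.15)–(3.16)
[cite: Leray1934, §21 (3.15) p. 226]; W. S. Ożański, B. C. Pooley, LMS Lecture Note Ser. 452 (2018),
Lemma 6.23 (i), Cor. 6.24 (i) [cite: OzanskiPooley2018, Lemma 6.23 (i)]; S. Palasek,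
arXiv:2605.13827 §4 [cite: Palasek2026ElementaryModel, §4].
-/

noncomputable section

namespace Summit.NavierStokesRegularity.FluidComputer.PalasekTowerClayBridge

open Set MeasureTheory Filter Topology Function Real
open scoped ENNReal ContDiff NNReal
open Literature.Analysis.FluidPDE

/-! ## §1 The Kato/Leray sub-window of a stage's growth window (any rates, margins, viscosity) -/

namespace Stage

/-- **The first `c₀ν/(c₂Y_k)²` of every growth window is controlled by the previous ceiling.**
There is a universal `c₀ > 0` (Leray's lifespan constant in Oseen's scheme) such that: for any
rates, any margins, any viscosity `ν > 0`, any QUIET schedule and any level `k ≥ 1`, every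
finite-energy classical solution `(u, p)` on a closed slab `[0, T'] × ℝ³`, `T' ≥ τ_k`, with the
schedule's force, which agrees in velocity with a registered stage `s` at level `k` on `[0, τ_k]`,
satisfies `|u(t, x)| ≤ 2 c₂ Y_k` for every `t ∈ [0, T']` with `t - τ_k < c₀ ν / (c₂ Y_k)²` and
every `x`. (On `[0, τ_k]`: the stage's ceiling. Past `τ_k`: the force is silent from `τ_1 ≤ τ_k`
on, the translate by `τ_k` is an unforced finite-energy classical solution from `s.u(τ_k)`, whose
sup is at most `c₂ Y_k`; Leray 1934 §21 (3.15) in the finite-energy form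
`exists_norm_le_two_mul_of_finiteEnergy`.) [cite: Leray1934, §21 (3.15) p. 226]
[cite: OzanskiPooley2018, Lemma 6.23 (i)] -/
theorem exists_kato_window :
    ∃ c₀ : ℝ, 0 < c₀ ∧ ∀ {ν : ℝ} {R : TowerRates} {S : Schedule R} {m : Margins R} {k : ℕ},
      0 < ν → S.Quiet → 1 ≤ k → ∀ (s : Stage ν R S m k) {T' : ℝ}, S.τ k ≤ T' →
      ∀ {u : ℝ → EuclideanSpace ℝ (Fin 3) → EuclideanSpace ℝ (Fin 3)}
        {p : ℝ → EuclideanSpace ℝ (Fin 3) → ℝ},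
        IsClassicalNSSolutionOn (Icc 0 T') ν S.f u p →
        (∀ t ∈ Icc 0 (S.τ k), u t = s.u t) →
        (∃ C : ℝ≥0∞, C < ⊤ ∧ ∀ t ∈ Icc 0 T', ∫⁻ x, ‖u t x‖ₑ ^ 2 ≤ C) →
        ∀ t ∈ Icc 0 T', t - S.τ k < c₀ * ν / (S.c₂ * R.Y k) ^ 2 →
          ∀ x, ‖u t x‖ ≤ 2 * (S.c₂ * R.Y k) := by
  obtain ⟨c₀, hc₀, hA⟩ := exists_norm_le_two_mul_of_finiteEnergy
  refine ⟨c₀, hc₀, ?_⟩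
  intro ν R S m k hν hQ hk s T' hT' u p hu hua hEu t ht htw x
  -- the level-`k` ceiling value `A = c₂ Y_k` is positive: floor `≤` ceiling at the readout
  set A : ℝ := S.c₂ * R.Y k with hAdef
  have hτk : 0 < S.τ k := S.τ_pos k
  have hApos : 0 < A := by
    obtain ⟨x₀, -, hfl⟩ := s.floor k le_rfl
    have hce := s.ceiling k le_rfl (S.τ k) ⟨hτk.le, le_rfl⟩ x₀
    have hY : 0 < R.Y k := Real.rpow_pos_of_pos (R.N_pos k) _
    have h1 : 0 < S.c₁ * R.Y k := mul_pos S.c₁_pos hY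
    rw [hAdef]
    linarith
  rcases le_or_gt t (S.τ k) with htk | htk
  · -- on `[0, τ_k]`: the stage's own ceiling
    rw [hua t ⟨ht.1, htk⟩]
    have := s.ceiling k le_rfl t ⟨ht.1, htk⟩ x
    rw [hAdef]
    linarith
  · -- past `τ_k`: translate by `τ_k`; the force is silent there
    have hτT' : S.τ k < T' := lt_of_lt_of_le htk ht.2
    have hf : ∀ r, S.τ k ≤ r → S.f r = 0 := fun r hr => hQ r ((S.τ_mono hk).trans hr)
    have hU : IsClassicalNSSolutionOn (Icc 0 (T' - S.τ k)) ν 0 (fun r => u (r + S.τ k))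
        (fun r => p (r + S.τ k)) :=
      isClassicalNSSolutionOn_translate_of_silent hu hτk.le hτT' hf
    have hEU : ∃ C : ℝ≥0∞, C < ⊤ ∧ ∀ r ∈ Icc 0 (T' - S.τ k), ∫⁻ x, ‖u (r + S.τ k) x‖ₑ ^ 2 ≤ C := by
      obtain ⟨C, hC, hb⟩ := hEu
      exact ⟨C, hC, fun r hr => hb (r + S.τ k) ⟨by linarith [hr.1], by linarith [hr.2]⟩⟩
    have hU0 : ∀ y, ‖(fun r => u (r + S.τ k)) 0 y‖ ≤ A := by
      intro y
      simp only [zero_add]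
      rw [hua (S.τ k) ⟨hτk.le, le_rfl⟩]
      exact s.ceiling k le_rfl (S.τ k) ⟨hτk.le, le_rfl⟩ y
    have key := hA hν (by linarith) hU hEU hApos hU0 (t - S.τ k)
      ⟨by linarith, by linarith [ht.2]⟩ htw x
    simpa only [sub_add_cancel] using key

end Stage

/-! ## §2 On the wide rates with the registered constants: inside the NEXT ceiling -/

/-- Under rigidity the registered ceiling constant is positive (`c₂ = 5/3`). [folklore] -/
theorem Schedule.Rigid.c₂_pos {R : TowerRates} {S : Schedule R} (h : S.Rigid) : 0 < S.c₂ := by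
  rw [h.c₂_eq]; norm_num

/-- On a rigid schedule over the wide rates, twice the level-`k` ceiling is inside the level-`k+1`
ceiling: `2 (c₂ Y_k) ≤ c₂ Y_{k+1}` (`TowerRates.wide_sep`). [folklore] -/
theorem Schedule.Rigid.two_mul_ceiling_le {S : Schedule TowerRates.wide} (h : S.Rigid) (k : ℕ) :
    2 * (S.c₂ * TowerRates.wide.Y k) ≤ S.c₂ * TowerRates.wide.Y (k + 1) := by
  have hsep := TowerRates.wide_sep k
  have hc := h.c₂_pos
  nlinarith

/-- **No overshoot of the next ceiling during the Kato/Leray sub-window — at every level `k ≥ 1`.**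
There is a universal `c₀ > 0` such that for every pinned (`Λ = 8`, `θ = 6/5`), rigid, quiet
schedule on the wide rates, every `k ≥ 1`, every globally anchored registered stage `s` at level
`k` (unit viscosity), every `T' ∈ [τ_k, τ_{k+1}]` and every classical solution `(u, p)` with the
schedule's force on `[0, T'] × ℝ³` agreeing with `s` in velocity and pressure on `[0, τ_k]` with
finite energy on `[0, T']`: `|u(t, x)| ≤ c₂ Y_{k+1}` for all `t ∈ [0, T']` with
`t - τ_k < c₀ / (c₂ Y_k)²`. These are the binders of `AprioriCeiling` (there for `k ≥ 2`), with the
conclusion restricted to the initial sub-window; the pins and the pressure agreement are not used.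
[cite: Leray1934, §21 (3.15) p. 226] [cite: OzanskiPooley2018, Lemma 6.23 (i)] -/
theorem exists_norm_le_ceiling_of_kato_window :
    ∃ c₀ : ℝ, 0 < c₀ ∧
      ∀ S : Schedule TowerRates.wide, S.Pins 8 (6 / 5) → S.Rigid → S.Quiet → ∀ k : ℕ, 1 ≤ k →
      ∀ s : Stage 1 TowerRates.wide S (Margins.routeG TowerRates.wide) k,
      ∀ T' ∈ Icc (S.τ k) (S.τ (k + 1)),
      ∀ (u : ℝ → EuclideanSpace ℝ (Fin 3) → EuclideanSpace ℝ (Fin 3))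
        (p : ℝ → EuclideanSpace ℝ (Fin 3) → ℝ),
        IsClassicalNSSolutionOn (Icc 0 T') 1 S.f u p →
        (∀ t ∈ Icc 0 (S.τ k), u t = s.u t ∧ p t = s.p t) →
        (∃ C : ℝ≥0∞, C < ⊤ ∧ ∀ t ∈ Icc 0 T', ∫⁻ x, ‖u t x‖ₑ ^ 2 ≤ C) →
        ∀ t ∈ Icc 0 T', t - S.τ k < c₀ / (S.c₂ * TowerRates.wide.Y k) ^ 2 →
          ∀ x, ‖u t x‖ ≤ S.c₂ * TowerRates.wide.Y (k + 1) := by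
  obtain ⟨c₀, hc₀, h⟩ := Stage.exists_kato_window
  refine ⟨c₀, hc₀, ?_⟩
  intro S _ hR hQ k hk s T' hT' u p hu hagree hEu t ht htw x
  have htw' : t - S.τ k < c₀ * 1 / (S.c₂ * TowerRates.wide.Y k) ^ 2 := by rwa [mul_one]
  have h1 := h one_pos hQ hk s hT'.1 hu (fun r hr => (hagree r hr).1) hEu t ht htw' x
  exact h1.trans (hR.two_mul_ceiling_le k)

/-! ## §3 The open content of the upper half is the LATE part of each window -/

/-- **`AprioriCeiling` is equivalent to its restriction to the late times of each window.** There is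
a universal `c₀ > 0` such that `AprioriCeiling` holds if and only if: for every pinned rigid quiet
schedule on the wide rates, every `k ≥ 2`, every registered stage `s` at level `k`, every
`T' ∈ [τ_k, τ_{k+1}]` and every finite-energy classical continuation `(u, p)` of `s` on `[0, T']`
(agreement in `u` and `p` on `[0, τ_k]`), `|u(t, x)| ≤ c₂ Y_{k+1}` for all `t ∈ [0, T']` with
`τ_k + c₀/(c₂Y_k)² ≤ t`. The early part of the window is `exists_norm_le_ceiling_of_kato_window`.
[cite: Leray1934, §21 (3.15)–(3.16) p. 226] [cite: OzanskiPooley2018, Cor. 6.24 (i)] -/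
theorem exists_aprioriCeiling_iff_late :
    ∃ c₀ : ℝ, 0 < c₀ ∧
      (AprioriCeiling ↔
        ∀ S : Schedule TowerRates.wide, S.Pins 8 (6 / 5) → S.Rigid → S.Quiet → ∀ k : ℕ, 2 ≤ k →
        ∀ s : Stage 1 TowerRates.wide S (Margins.routeG TowerRates.wide) k,
        ∀ T' ∈ Icc (S.τ k) (S.τ (k + 1)),
        ∀ (u : ℝ → EuclideanSpace ℝ (Fin 3) → EuclideanSpace ℝ (Fin 3))
          (p : ℝ → EuclideanSpace ℝ (Fin 3) → ℝ),
          IsClassicalNSSolutionOn (Icc 0 T') 1 S.f u p →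
          (∀ t ∈ Icc 0 (S.τ k), u t = s.u t ∧ p t = s.p t) →
          (∃ C : ℝ≥0∞, C < ⊤ ∧ ∀ t ∈ Icc 0 T', ∫⁻ x, ‖u t x‖ₑ ^ 2 ≤ C) →
          ∀ t ∈ Icc 0 T', S.τ k + c₀ / (S.c₂ * TowerRates.wide.Y k) ^ 2 ≤ t →
            ∀ x, ‖u t x‖ ≤ S.c₂ * TowerRates.wide.Y (k + 1)) := by
  obtain ⟨c₀, hc₀, h⟩ := exists_norm_le_ceiling_of_kato_window
  refine ⟨c₀, hc₀, ⟨fun hA S hP hR hQ k hk s T' hT' u p hu hag hE t ht _ x =>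
    hA S hP hR hQ k hk s T' hT' u p hu hag hE t ht x, fun hL => ?_⟩⟩
  intro S hP hR hQ k hk s T' hT' u p hu hag hE t ht x
  rcases lt_or_ge t (S.τ k + c₀ / (S.c₂ * TowerRates.wide.Y k) ^ 2) with hlt | hge
  · exact h S hP hR hQ k (by omega) s T' hT' u p hu hag hE t ht (by linarith) x
  · exact hL S hP hR hQ k hk s T' hT' u p hu hag hE t ht hge x

/-- The same split read on `HeredityFrom 2`: the child crux `HeredityFromTwo` is EXACTLY «no
overshoot of `c₂Y_{k+1}` on the late part `[τ_k + c₀/(c₂Y_k)², τ_{k+1}]` of each window» together with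
the readout floors (`heredityFrom_two_iff_aprioriCeiling_and_floors`). [folklore] -/
theorem exists_heredityFrom_two_iff_late_and_floors :
    ∃ c₀ : ℝ, 0 < c₀ ∧
      (HeredityFrom 2 ↔
        (∀ S : Schedule TowerRates.wide, S.Pins 8 (6 / 5) → S.Rigid → S.Quiet → ∀ k : ℕ, 2 ≤ k →
        ∀ s : Stage 1 TowerRates.wide S (Margins.routeG TowerRates.wide) k,
        ∀ T' ∈ Icc (S.τ k) (S.τ (k + 1)),
        ∀ (u : ℝ → EuclideanSpace ℝ (Fin 3) → EuclideanSpace ℝ (Fin 3))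
          (p : ℝ → EuclideanSpace ℝ (Fin 3) → ℝ),
          IsClassicalNSSolutionOn (Icc 0 T') 1 S.f u p →
          (∀ t ∈ Icc 0 (S.τ k), u t = s.u t ∧ p t = s.p t) →
          (∃ C : ℝ≥0∞, C < ⊤ ∧ ∀ t ∈ Icc 0 T', ∫⁻ x, ‖u t x‖ₑ ^ 2 ≤ C) →
          ∀ t ∈ Icc 0 T', S.τ k + c₀ / (S.c₂ * TowerRates.wide.Y k) ^ 2 ≤ t →
            ∀ x, ‖u t x‖ ≤ S.c₂ * TowerRates.wide.Y (k + 1)) ∧ ReadoutFloors) := by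
  obtain ⟨c₀, hc₀, h⟩ := exists_aprioriCeiling_iff_late
  exact ⟨c₀, hc₀, heredityFrom_two_iff_aprioriCeiling_and_floors.trans (and_congr_left fun _ => h)⟩

/-! ## §4 The number: which fraction of the rigid window is covered -/

/-- **The covered fraction.** Under rigidity, the Kato/Leray sub-window `c₀ ν/(c₂Y_k)²` (at `ν = 1`)
is the fraction `c₀ / (c₂² · 4bβ · log N_{k+1} · N_k^{β-2})` of the growth window `τ_{k+1} - τ_k`
(`Schedule.Rigid.window_mul_ceiling_sq`): on the wide rates the denominator is `≈ 1.55·10³` at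
`k = 2` and tends to infinity with `k` (`β > 2`), while `c₀` is a fixed small constant — the theorem
above clears the START of each window and leaves the bulk open. [folklore] -/
theorem Schedule.Rigid.kato_fraction {R : TowerRates} {S : Schedule R} (h : S.Rigid) (k : ℕ)
    (c₀ : ℝ) :
    c₀ / (S.c₂ * R.Y k) ^ 2 =
      (c₀ / (S.c₂ ^ 2 * (4 * R.b * R.β) * Real.log (R.N (k + 1)) * R.N k ^ (R.β - 2))) *
        (S.τ (k + 1) - S.τ k) := by
  have hw := h.window_mul_ceiling_sq k
  have hY : 0 < R.Y k := Real.rpow_pos_of_pos (R.N_pos k) _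
  have hc : 0 < S.c₂ := h.c₂_pos
  have hA2 : 0 < (S.c₂ * R.Y k) ^ 2 := by positivity
  have hwin : 0 < S.τ (k + 1) - S.τ k := by linarith [S.τ_lt_succ k]
  have hD : 0 < S.c₂ ^ 2 * (4 * R.b * R.β) * Real.log (R.N (k + 1)) * R.N k ^ (R.β - 2) := by
    rw [← hw]; positivity
  rw [← hw]
  field_simp

/-! ## §5 Existence on the Kato/Leray sub-window: the stage's flow EXISTS there, inside the next
ceiling (levels `k ≥ 2`; append, seat `ns-blowup-ecbridge-8` g2)

The ∀-bound of §1 feeds the a-priori continuation theorem of `PalasekTowerRegisterGlobalApriori`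
(`Stage.exists_continuation_of_apriori`, ecbridge-5 g2: existence is free, only the bound is a
hypothesis): on the Kato/Leray sub-window the bound IS a theorem, so the continuation EXISTS there —
the `ContinuationEnvelope` half of `HeredityFromTwo` restricted to `[0, τ_k + c₀ν/(c₂Y_k)²]` holds
outright, with no hypothesis and no named fact. -/

namespace Stage

/-- **Every registered stage at a generic level continues, inside twice its own ceiling, across the
Kato/Leray sub-window** (any rates, any margins, any `ν > 0`, quiet schedule, `k ≥ 2`). There is a
universal `c₀ > 0` such that every stage `s` at level `k ≥ 2` has a finite-energy classical
continuation `(u, p)` (schedule's force; agreement with `s` in velocity AND pressure on `[0, τ_k]`)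
on the closed slab `[0, τ_k + c₀ν/(c₂Y_k)²]`, bounded there by `2 c₂ Y_k`. Proof: the a-priori
continuation `exists_continuation_of_apriori` with `M = 2c₂Y_k`, the a-priori bound being
`exists_kato_window` (Leray 1934 §21 (3.15) for finite-energy classical solutions); the exported
constant is half the Literature one so that the closed slab sits inside the strict window.
[cite: Leray1934, §19 (3.8) p. 223 and §21 (3.15) p. 226] [cite: RobinsonRodrigoSadowski2016, Thm. 8.17] -/
theorem exists_continuation_kato_window :
    ∃ c₀ : ℝ, 0 < c₀ ∧ ∀ {ν : ℝ} {R : TowerRates} {S : Schedule R} {m : Margins R} {k : ℕ},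
      0 < ν → S.Quiet → 2 ≤ k → ∀ s : Stage ν R S m k,
      ∃ (u : ℝ → EuclideanSpace ℝ (Fin 3) → EuclideanSpace ℝ (Fin 3))
        (p : ℝ → EuclideanSpace ℝ (Fin 3) → ℝ),
        IsClassicalNSSolutionOn (Icc 0 (S.τ k + c₀ * ν / (S.c₂ * R.Y k) ^ 2)) ν S.f u p ∧
        (∀ t ∈ Icc 0 (S.τ k), u t = s.u t ∧ p t = s.p t) ∧
        (∃ C : ℝ≥0∞, C < ⊤ ∧
          ∀ t ∈ Icc 0 (S.τ k + c₀ * ν / (S.c₂ * R.Y k) ^ 2), ∫⁻ x, ‖u t x‖ₑ ^ 2 ≤ C) ∧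
        ∀ t ∈ Icc 0 (S.τ k + c₀ * ν / (S.c₂ * R.Y k) ^ 2), ∀ x, ‖u t x‖ ≤ 2 * (S.c₂ * R.Y k) := by
  obtain ⟨c₀, hc₀, hK⟩ := exists_kato_window
  refine ⟨c₀ / 2, half_pos hc₀, ?_⟩
  intro ν R S m k hν hQ hk s
  set A : ℝ := S.c₂ * R.Y k with hAdef
  have hτk : 0 < S.τ k := S.τ_pos k
  have hApos : 0 < A := by
    obtain ⟨x₀, -, hfl⟩ := s.floor k le_rfl
    have hce := s.ceiling k le_rfl (S.τ k) ⟨hτk.le, le_rfl⟩ x₀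
    have hY : 0 < R.Y k := Real.rpow_pos_of_pos (R.N_pos k) _
    have h1 : 0 < S.c₁ * R.Y k := mul_pos S.c₁_pos hY
    rw [hAdef]
    linarith
  set T₁ : ℝ := S.τ k + c₀ / 2 * ν / A ^ 2 with hT₁
  have hδ : 0 < c₀ / 2 * ν / A ^ 2 := by positivity
  have hδ' : c₀ / 2 * ν / A ^ 2 < c₀ * ν / A ^ 2 := by
    rw [div_lt_div_iff_of_pos_right (pow_pos hApos 2)]
    nlinarith
  have hT₁k : S.τ k ≤ T₁ := by rw [hT₁]; linarith
  have hk1 : 1 ≤ k := by omega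
  -- the a-priori bound `2A` on `[τ_k, T']`, `T' ≤ T₁`, for every finite-energy continuation (§1)
  have hM : ∀ T' ∈ Icc (S.τ k) T₁,
      ∀ (u : ℝ → EuclideanSpace ℝ (Fin 3) → EuclideanSpace ℝ (Fin 3))
        (p : ℝ → EuclideanSpace ℝ (Fin 3) → ℝ),
      IsClassicalNSSolutionOn (Icc 0 T') ν S.f u p →
      (∀ t ∈ Icc 0 (S.τ k), u t = s.u t ∧ p t = s.p t) →
      (∃ C : ℝ≥0∞, C < ⊤ ∧ ∀ t ∈ Icc 0 T', ∫⁻ x, ‖u t x‖ₑ ^ 2 ≤ C) →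
      ∀ t ∈ Icc (S.τ k) T', ∀ x, ‖u t x‖ ≤ 2 * A := by
    intro T' hT' u p hu hag hE t ht x
    have htw : t - S.τ k < c₀ * ν / (S.c₂ * R.Y k) ^ 2 := by
      have h1 : t - S.τ k ≤ c₀ / 2 * ν / A ^ 2 := by rw [hT₁] at hT'; linarith [ht.2, hT'.2]
      exact lt_of_le_of_lt h1 hδ'
    exact hK hν hQ hk1 s hT'.1 hu (fun r hr => (hag r hr).1) hE t ⟨hτk.le.trans ht.1, ht.2⟩ htw x
  obtain ⟨u, p, hcl, hag, hE⟩ := s.exists_continuation_of_apriori hν hQ hk hT₁k hM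
  refine ⟨u, p, hcl, hag, hE, fun t ht x => ?_⟩
  rcases le_or_gt t (S.τ k) with htk | htk
  · -- before `τ_k`: the stage's ceiling
    rw [(hag t ⟨ht.1, htk⟩).1]
    have := s.ceiling k le_rfl t ⟨ht.1, htk⟩ x
    rw [hAdef]
    linarith
  · exact hM T₁ ⟨hT₁k, le_rfl⟩ u p hcl hag hE t ⟨htk.le, ht.2⟩ x

end Stage

/-- **`ContinuationEnvelope` on the Kato/Leray sub-window is a theorem** (wide rates, registered
constants, `k ≥ 2`). There is a universal `c₀ > 0` such that, for every pinned rigid quiet schedule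
on the wide rates and every `k ≥ 2`, every globally anchored registered stage `s` at level `k` (unit
viscosity) has a finite-energy classical continuation on `[0, τ_k + c₀/(c₂Y_k)²]` agreeing with `s`
in velocity and pressure on `[0, τ_k]` and INSIDE THE NEXT CEILING `c₂ Y_{k+1}` there — the
conclusion of `ContinuationEnvelope` with `τ_{k+1}` replaced by `τ_k + c₀/(c₂Y_k)²`, with no
hypothesis and no named fact. (The remaining `τ_{k+1} - τ_k - c₀/(c₂Y_k)²`, i.e. all but the fraction
`Schedule.Rigid.kato_fraction` of the window, is the open content.)
[cite: Leray1934, §21 (3.15) p. 226] [cite: RobinsonRodrigoSadowski2016, Thm. 8.17] -/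
theorem exists_continuationEnvelope_kato_window :
    ∃ c₀ : ℝ, 0 < c₀ ∧
      ∀ S : Schedule TowerRates.wide, S.Pins 8 (6 / 5) → S.Rigid → S.Quiet → ∀ k : ℕ, 2 ≤ k →
      ∀ s : Stage 1 TowerRates.wide S (Margins.routeG TowerRates.wide) k,
      ∃ (u : ℝ → EuclideanSpace ℝ (Fin 3) → EuclideanSpace ℝ (Fin 3))
        (p : ℝ → EuclideanSpace ℝ (Fin 3) → ℝ),
        IsClassicalNSSolutionOn (Icc 0 (S.τ k + c₀ / (S.c₂ * TowerRates.wide.Y k) ^ 2)) 1 S.f u p ∧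
        (∀ t ∈ Icc 0 (S.τ k), u t = s.u t ∧ p t = s.p t) ∧
        (∃ C : ℝ≥0∞, C < ⊤ ∧
          ∀ t ∈ Icc 0 (S.τ k + c₀ / (S.c₂ * TowerRates.wide.Y k) ^ 2), ∫⁻ x, ‖u t x‖ₑ ^ 2 ≤ C) ∧
        ∀ t ∈ Icc 0 (S.τ k + c₀ / (S.c₂ * TowerRates.wide.Y k) ^ 2), ∀ x,
          ‖u t x‖ ≤ S.c₂ * TowerRates.wide.Y (k + 1) := by
  obtain ⟨c₀, hc₀, h⟩ := Stage.exists_continuation_kato_window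
  refine ⟨c₀, hc₀, ?_⟩
  intro S _ hR hQ k hk s
  obtain ⟨u, p, hcl, hag, hE, hb⟩ := h one_pos hQ hk s
  have hw : S.τ k + c₀ * 1 / (S.c₂ * TowerRates.wide.Y k) ^ 2 =
      S.τ k + c₀ / (S.c₂ * TowerRates.wide.Y k) ^ 2 := by rw [mul_one]
  rw [hw] at hcl hE hb
  exact ⟨u, p, hcl, hag, hE, fun t ht x => (hb t ht x).trans (hR.two_mul_ceiling_le k)⟩

end Summit.NavierStokesRegularity.FluidComputer.PalasekTowerClayBridge

end
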